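import Literature.Analysis.FluidPDE.PineauVicolRSSHolds
import HarnessLib

/-!
# Route TypeICertificateLadder — crux `Target` (item stmt-NavierStokesRegularity-1217),
# line `killing-twisted-bernoulli-solitons`: joint smoothness of the RSS ansatz field

Helper file (theorems only) for the compactness step of the window-Liouville programme
(stub `rssCompact_contDiffOn_pvAnsatz`). For a smooth time-independent profile
`U : ℝ³ → ℝ³` and a rotation speed `α`, the Pineau–Vicol rotated self-similar ansatz field
`u(t, x) = (−t)^{−1/2} R(αs) U(R(−αs) x/√(−t))`, `s = −log(−t)` (`pvAnsatz α (fun y _ => U y)`,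
arXiv:2607.09619 (1.7)) is jointly `C^∞` in `(t, x)` on the open slab `t < 0`.

The only point is the joint smoothness of `(θ, v) ↦ R_θ v` in the angle and the vector, which
follows from the expansion through the generator `J = rotGen`:
`R_θ v = v + sin θ • Jv + (1 − cos θ) • J(Jv)` (a sum of smooth scalar functions of `θ` times
continuous linear maps of `v`). The scalar factors `(−t)^{−1/2}` and `log(−t)` are smooth on
`t < 0`.
-/

noncomputable section

namespace Summit.NavierStokesRegularity.NavierStokesRegularity.Theorems

open Set Function
open Literature.Analysis.FluidPDE
open scoped ContDiff

/-- The rotation about the axis through its (continuous linear) generator: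
`R_θ v = v + sin θ • Jv + (1 − cos θ) • J(Jv)` (`J = rotGenL`). [folklore] -/
private theorem rssCompact_rotZ_eq_rotGenL (θ : ℝ) (v : EuclideanSpace ℝ (Fin 3)) :
    rotZ θ v = v + Real.sin θ • rotGenL v + (1 - Real.cos θ) • rotGenL (rotGenL v) := by
  ext i
  fin_cases i <;> simp [rotZ, rotGen] <;> ring

/-- Joint smoothness of the rotation in the angle and the vector: if `θ : E → ℝ` and
`V : E → ℝ³` are `Cⁿ` on `s`, so is `z ↦ R_{θ(z)} V(z)`. [folklore] -/
private theorem rssCompact_contDiffOn_rotZ {E : Type*} [NormedAddCommGroup E] [NormedSpace ℝ E]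
    {n : WithTop ℕ∞} {s : Set E} {θ : E → ℝ} {V : E → EuclideanSpace ℝ (Fin 3)}
    (hθ : ContDiffOn ℝ n θ s) (hV : ContDiffOn ℝ n V s) :
    ContDiffOn ℝ n (fun z => rotZ (θ z) (V z)) s := by
  have e : (fun z => rotZ (θ z) (V z)) = fun z =>
      V z + Real.sin (θ z) • rotGenL (V z) + (1 - Real.cos (θ z)) • rotGenL (rotGenL (V z)) :=
    funext fun z => rssCompact_rotZ_eq_rotGenL _ _
  rw [e]
  have hJ : ContDiffOn ℝ n (fun z => rotGenL (V z)) s := rotGenL.contDiff.comp_contDiffOn hV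
  have hJJ : ContDiffOn ℝ n (fun z => rotGenL (rotGenL (V z))) s :=
    rotGenL.contDiff.comp_contDiffOn hJ
  exact (hV.add ((Real.contDiff_sin.comp_contDiffOn hθ).smul hJ)).add
    ((contDiffOn_const.sub (Real.contDiff_cos.comp_contDiffOn hθ)).smul hJJ)

/-- **Joint smoothness of the RSS ansatz field of a smooth time-independent profile.** For
`U ∈ C^∞(ℝ³; ℝ³)` and every `α`, the field `(t, x) ↦ (−t)^{−1/2} R(αs) U(R(−αs) x/√(−t))`,
`s = −log(−t)` (Pineau–Vicol (1.7)), is `C^∞` on `(−∞, 0) × ℝ³`. [folklore] -/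
theorem rssCompact_contDiffOn_pvAnsatz :
    ∀ (α : ℝ) (U : EuclideanSpace ℝ (Fin 3) → EuclideanSpace ℝ (Fin 3)), ContDiff ℝ (⊤ : ℕ∞) U →
      ContDiffOn ℝ (⊤ : ℕ∞) (uncurry (Literature.Analysis.FluidPDE.pvAnsatz α (fun y _ => U y)))
        (Iio (0 : ℝ) ×ˢ (univ : Set (EuclideanSpace ℝ (Fin 3)))) := by
  intro α U hU
  have hpos : ∀ z ∈ Iio (0 : ℝ) ×ˢ (univ : Set (EuclideanSpace ℝ (Fin 3))), 0 < -z.1 :=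
    fun z hz => neg_pos.2 (mem_Iio.1 hz.1)
  -- the scalar ingredients `-t`, `(√(-t))⁻¹`, `θ = α · (−log(−t))`
  have hneg : ContDiffOn ℝ ∞ (fun z : ℝ × EuclideanSpace ℝ (Fin 3) => -z.1)
      (Iio (0 : ℝ) ×ˢ univ) := contDiffOn_fst.neg
  have hL : ContDiffOn ℝ ∞ (fun z : ℝ × EuclideanSpace ℝ (Fin 3) => (Real.sqrt (-z.1))⁻¹)
      (Iio (0 : ℝ) ×ˢ univ) :=
    (hneg.sqrt fun z hz => (hpos z hz).ne').inv fun z hz => (Real.sqrt_pos.2 (hpos z hz)).ne'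
  have hθ : ContDiffOn ℝ ∞ (fun z : ℝ × EuclideanSpace ℝ (Fin 3) => α * -Real.log (-z.1))
      (Iio (0 : ℝ) ×ˢ univ) :=
    contDiffOn_const.mul (hneg.log fun z hz => (hpos z hz).ne').neg
  -- the inner point `y = R(−θ) (λ x)`, the profile there, the outer rotation, the amplitude
  have hy : ContDiffOn ℝ ∞ (fun z : ℝ × EuclideanSpace ℝ (Fin 3) =>
      rotZ (-(α * -Real.log (-z.1))) ((Real.sqrt (-z.1))⁻¹ • z.2)) (Iio (0 : ℝ) ×ˢ univ) :=
    rssCompact_contDiffOn_rotZ hθ.neg (hL.smul contDiffOn_snd)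
  have hUy : ContDiffOn ℝ ∞ (fun z : ℝ × EuclideanSpace ℝ (Fin 3) =>
      U (rotZ (-(α * -Real.log (-z.1))) ((Real.sqrt (-z.1))⁻¹ • z.2))) (Iio (0 : ℝ) ×ˢ univ) :=
    hU.comp_contDiffOn hy
  have hR : ContDiffOn ℝ ∞ (fun z : ℝ × EuclideanSpace ℝ (Fin 3) =>
      rotZ (α * -Real.log (-z.1)) (U (rotZ (-(α * -Real.log (-z.1))) ((Real.sqrt (-z.1))⁻¹ • z.2))))
      (Iio (0 : ℝ) ×ˢ univ) :=
    rssCompact_contDiffOn_rotZ hθ hUy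
  exact (hL.smul hR).congr fun z _ => rfl

end Summit.NavierStokesRegularity.NavierStokesRegularity.Theorems

end
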